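import Summits.CriticalPhenomena.CardyFormulaZ2.Theorems.CardyComplexConeSLESixFamiliesGiveCardyDefs
import Literature.Topology.PlaneTopology.Crosscut

/-!
# drefute gen-6 — the UNIFORM side-ball lemma for STUB A `stub_upperFence` (crux
`SLESixFamiliesGiveCardy`, stmt-CriticalPhenomena-9654, line `collar-touch-sandwich`)

The only genuinely `ω`-uniform topological input of the fence argument.  Newman's cross-cut
theorem (`Newman1939_crosscut`) gives, for the cleaned cross-cut `L′ ⊆ closure Ω` from
`D.boundary s` to `D.boundary t`, `frontier U₁ = L′ ∪ D.boundary '' Icc s t`; to put the first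
inner face of the exploration (which lies within `O(δ)` of the mark `a⁺ = D.boundary u₀ ∉ closure Ω`)
in `U₂` for ALL configurations at once one needs a radius `τ > 0`, depending only on `D`, the
closed set `C = closure Ω` and `u₀`, such that `B(a⁺, τ)` misses `C` (hence `L′`) and misses EVERY
boundary arc `D.boundary '' Icc s t` whose end-parameters `s, t` are `C`-parameters and which does
not pass through `a⁺` (`u₀ + k ∉ [s, t]` for all `k : ℤ`).  Proof: with `S = {v | D.boundary v ∈ C}`
(closed, `1`-periodic, `u₀ ∉ S`), `uP = inf (S ∩ [u₀, ∞))`, `uM = sup (S ∩ (-∞, u₀])`, every such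
arc lies in the compact `K₀ = D.boundary '' [uP, uM + 1] ∌ a⁺` (injectivity on a period).
Then `DrefuteG6.ball_disjoint_of_disjoint_frontier` (`UpperFenceSideLemmasG6.lean`) finishes:
`B(a⁺, τ) ∩ U₁ = ∅`.  Positive helper, NOT a refutation. `lean check`: rc 0, 0 sorries, 0 warnings.
-/

noncomputable section

open Set Filter Topology Metric
open Literature.Probability Literature.Probability.RandomPlanarGeometry

namespace Summit.CriticalPhenomena.CardyFormulaZ2.Cruxes.SLESixFamiliesGiveCardy.CollarTouchSandwich

namespace DrefuteG6

/-- **Uniform side ball.**  For a Jordan domain `D`, a closed set `C` and a boundary point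
`D.boundary u₀ ∉ C` there is `τ > 0` such that the ball `B(D.boundary u₀, τ)` misses `C` and
misses every boundary arc `D.boundary '' Icc s t` with `D.boundary s, D.boundary t ∈ C` not passing
through the parameter `u₀` modulo `1`. [folklore] -/
theorem _root_.Literature.Probability.RandomPlanarGeometry.JordanDomain.exists_uniform_side_ball
    (D : JordanDomain) {C : Set ℂ} (hC : IsClosed C) {u₀ : ℝ} (h0 : D.boundary u₀ ∉ C) :
    ∃ τ > 0, Disjoint (ball (D.boundary u₀) τ) C ∧
      ∀ s t : ℝ, D.boundary s ∈ C → D.boundary t ∈ C → (∀ k : ℤ, u₀ + k ∉ Icc s t) →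
        Disjoint (ball (D.boundary u₀) τ) (D.boundary '' Icc s t) := by
  classical
  -- a ball missing `C`
  obtain ⟨τ₁, hτ₁, hball₁⟩ : ∃ τ₁ > 0, ball (D.boundary u₀) τ₁ ⊆ Cᶜ :=
    Metric.isOpen_iff.1 hC.isOpen_compl _ h0
  -- the closed, `1`-periodic parameter set of `C`
  set S : Set ℝ := {v | D.boundary v ∈ C} with hS
  have hSc : IsClosed S := hC.preimage D.continuous_boundary
  have hper : ∀ (v : ℝ) (k : ℤ), D.boundary (v + k) = D.boundary v := fun v k => by
    have := (D.periodic_boundary.int_mul k) v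
    simpa using this
  have hSper : ∀ (v : ℝ) (k : ℤ), v + k ∈ S ↔ v ∈ S := fun v k => by
    simp only [hS, mem_setOf_eq, hper]
  have hu₀S : u₀ ∉ S := h0
  by_cases hSne : S.Nonempty
  swap
  · refine ⟨τ₁, hτ₁, Set.disjoint_left.2 fun z hz hzC => hball₁ hz hzC, fun s t hs _ _ => ?_⟩
    exact absurd ⟨s, show s ∈ S from hs⟩ hSne
  obtain ⟨v₀, hv₀⟩ := hSne
  have hup : (S ∩ Ici u₀).Nonempty := by
    refine ⟨v₀ + (⌈u₀ - v₀⌉ : ℤ), (hSper _ _).2 hv₀, ?_⟩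
    show u₀ ≤ v₀ + ((⌈u₀ - v₀⌉ : ℤ) : ℝ)
    have := Int.le_ceil (u₀ - v₀)
    linarith
  have hdown : (S ∩ Iic u₀).Nonempty := by
    refine ⟨v₀ + (⌊u₀ - v₀⌋ : ℤ), (hSper _ _).2 hv₀, ?_⟩
    show v₀ + ((⌊u₀ - v₀⌋ : ℤ) : ℝ) ≤ u₀
    have := Int.floor_le (u₀ - v₀)
    linarith
  have hbddP : BddBelow (S ∩ Ici u₀) := ⟨u₀, fun v hv => hv.2⟩
  have hbddM : BddAbove (S ∩ Iic u₀) := ⟨u₀, fun v hv => hv.2⟩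
  set uP : ℝ := sInf (S ∩ Ici u₀) with huP
  set uM : ℝ := sSup (S ∩ Iic u₀) with huM
  have huPmem : uP ∈ S ∩ Ici u₀ := (hSc.inter isClosed_Ici).csInf_mem hup hbddP
  have huMmem : uM ∈ S ∩ Iic u₀ := (hSc.inter isClosed_Iic).csSup_mem hdown hbddM
  have huPgt : u₀ < uP :=
    lt_of_le_of_ne huPmem.2 fun h => hu₀S (by rw [h]; exact huPmem.1)
  have huMlt : uM < u₀ :=
    lt_of_le_of_ne huMmem.2 fun h => hu₀S (by rw [← h]; exact huMmem.1)
  -- the free interval `(uM, uP)` and its integer translates miss `S`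
  have hfree : ∀ v, uM < v → v < uP → v ∉ S := by
    intro v hv1 hv2 hvS
    rcases le_or_gt v u₀ with h | h
    · exact not_lt.2 (le_csSup hbddM ⟨hvS, h⟩) hv1
    · exact not_lt.2 (csInf_le hbddP ⟨hvS, h.le⟩) hv2
  have hfreeK : ∀ (v : ℝ) (k : ℤ), uM + k < v → v < uP + k → v ∉ S := by
    intro v k h1 h2 hvS
    have h' : v - k ∈ S := by
      have := hSper (v - k) k
      rw [sub_add_cancel] at this
      exact this.1 hvS
    exact hfree (v - k) (by linarith) (by linarith) h'
  -- `u₀ < uM + 1`, hence `uP ≤ uM + 1`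
  have huM1S : uM + 1 ∈ S := by
    have := (hSper uM 1).2 huMmem.1
    simpa using this
  have huM1 : u₀ < uM + 1 := by
    by_contra hle
    push Not at hle
    have := le_csSup hbddM ⟨huM1S, hle⟩
    linarith
  have huPle : uP ≤ uM + 1 := csInf_le hbddP ⟨huM1S, huM1.le⟩
  -- the compact arc `K₀ = boundary [uP, uM + 1]`, which misses the mark
  set K₀ : Set ℂ := D.boundary '' Icc uP (uM + 1) with hK₀
  have hK₀c : IsClosed K₀ := (isCompact_Icc.image D.continuous_boundary).isClosed
  have haK₀ : D.boundary u₀ ∉ K₀ := by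
    rintro ⟨w, hw, hwa⟩
    have hwI : w ∈ Ico u₀ (u₀ + 1) := ⟨huPgt.le.trans hw.1, by linarith [hw.2, huMlt]⟩
    have hu₀I : u₀ ∈ Ico u₀ (u₀ + 1) := ⟨le_rfl, by linarith⟩
    have := D.injOn_boundary_Ico u₀ hwI hu₀I hwa
    linarith [hw.1]
  obtain ⟨τ₂, hτ₂, hball₂⟩ : ∃ τ₂ > 0, ball (D.boundary u₀) τ₂ ⊆ K₀ᶜ :=
    Metric.isOpen_iff.1 hK₀c.isOpen_compl _ haK₀
  refine ⟨min τ₁ τ₂, lt_min hτ₁ hτ₂, ?_, ?_⟩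
  · exact Set.disjoint_left.2 fun z hz hzC => hball₁ (ball_subset_ball (min_le_left _ _) hz) hzC
  · intro s t hs ht hk
    -- every such arc lies in `K₀`
    have harc : D.boundary '' Icc s t ⊆ K₀ := by
      rintro _ ⟨v, hv, rfl⟩
      have hv_free : ∀ k : ℤ, ¬ (uM + k < v ∧ v < uP + k) := by
        rintro k ⟨h1, h2⟩
        have hs' : s ≤ uM + k := by
          by_contra h
          push Not at h
          exact hfreeK s k h (lt_of_le_of_lt hv.1 h2) hs
        have ht' : uP + k ≤ t := by
          by_contra h
          push Not at h
          exact hfreeK t k (lt_of_lt_of_le h1 hv.2) h ht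
        exact hk k ⟨by linarith, by linarith⟩
      set k : ℤ := ⌊v - uP⌋ with hk'
      have h1 : uP ≤ v - k := by
        have := Int.floor_le (v - uP)
        linarith
      have h2 : v - k < uP + 1 := by
        have := Int.lt_floor_add_one (v - uP)
        linarith
      have h3 : v - k ≤ uM + 1 := by
        by_contra h
        push Not at h
        refine hv_free (k + 1) ⟨?_, ?_⟩ <;> push_cast <;> linarith
      refine ⟨v - k, ⟨h1, h3⟩, ?_⟩
      have := hper (v - k) k
      rw [sub_add_cancel] at this
      exact this.symm
    exact Set.disjoint_left.2 fun z hz hzA =>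
      hball₂ (ball_subset_ball (min_le_right _ _) hz) (harc hzA)

/-- Bookkeeping for the hypothesis of `exists_uniform_side_ball`: if `u₀ < s` and `t < u₀ + 1`
then no integer translate of `u₀` lies in `[s, t]`.  (For the mark `a⁺ = D.pt 0` take
`u₀ = D.mark 0` and the cleaned cross-cut parameters `s ∈ (mark 0, mark 1)`, `t ∈ (mark 1, mark 0 + 1)`;
for `b⁺ = D.pt 1` apply it to `u₀ = D.mark 1` and the complementary arc `[t, s + 1]`.) [folklore] -/
theorem forall_int_add_notMem_Icc {u₀ s t : ℝ} (hs : u₀ < s) (ht : t < u₀ + 1) :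
    ∀ k : ℤ, u₀ + k ∉ Icc s t := by
  intro k hk
  rcases le_or_gt k 0 with h | h
  · have : (k : ℝ) ≤ 0 := by exact_mod_cast h
    linarith [hk.1]
  · have h1 : (1 : ℤ) ≤ k := by omega
    have : (1 : ℝ) ≤ k := by exact_mod_cast h1
    linarith [hk.2]

end DrefuteG6

end Summit.CriticalPhenomena.CardyFormulaZ2.Cruxes.SLESixFamiliesGiveCardy.CollarTouchSandwich
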